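import Literature.IUT.HodgeArakelov.ModelCyclotomes
import Literature.IUT.HodgeArakelov.Def11OutputTransport
import Literature.AnabelianGeometry.EtaleTheta.Discharge.Sec2TowerLemmas

/-!
# Bridge B8, part 5b: the [IUTchII] Def. 1.1 output (`Reconstruction`, `CyclotomicRigidity`, `Def11Output`)
# of the [EtTh] model mono-theta environment, from L2's `RigidData`

abc-iut cell, MERGE-MAP §1 gate «L2-t2 `ThetaRigidity` (`RigidData`, p405849) → abc-iut-L6-t1
`CyclotomicRigidity`/`Def11Output` (`MonoThetaCyclotomes`, p405104)», inside bridge **B8** (abc-iut-L6-d6);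
continuation of `ModelCyclotomes` (part 5a) and `Def11OutputTransport` (part 4).

[IUTchII] Def. 1.1 (i), (ii) (kurims pp. 20–21) asserts "functorial group-theoretic algorithms" producing from a
mono-theta environment `M` the data `Π_M ↠ Π_Y(M) ⊆ Π_X(M) ↠ G(M)`, `(l·Δ_Θ)(M)`, `Π_μ(M)` with their actions, and
the cyclotomic rigidity isomorphism `(l·Δ_Θ)(M) ⊗ ℤ/Nℤ ≅ Π_μ(M)` [cf. [EtTh] Cor. 2.18 (i), (iii), 2.19 (i)];
abc-iut-L6-t1 typed the OUTPUT (`Reconstruction M`, `CyclotomicRigidity`, `Def11Output M`) and left the EXISTENCE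
to "the construction for the genuine mono-theta environment of [EtTh]". This file CONSTRUCTS it for every
`M : MonoThetaEnv S` whose underlying topological group is identified with the model `Π^tp_Y[μ_N] = μ_N ⋊ Π^tp_Y`
of an `R : RigidData S.N l` (L2's [EtTh] §2 interface), over a `ModelFrame S R` recording how `R` sits in the
[IUTchII] §1 setting `S` (`Π^tp_X ≅ S.PiX` carrying `Δ` to `Δ`) together with the three properties the [EtTh]
interface does not carry (`Π^tp_X` is T₁, `Δ_X` is closed, `(l·Δ_Θ)/thetaKer ≅ Ẑ` abstractly):

* `Π_Y(M) := Π^tp_Y`, `Π_M ↠ Π_Y(M) :=` the semidirect-product projection after `Π_M ≅ Π^tp_Y[μ_N]` (a quotient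
  map: `Π^tp_Y[μ_N] ≃ₜ μ_N × Π^tp_Y`, `envHomeoProd`); `Π_X(M) := Π^tp_X ⊇ Π^tp_Y` (open, normal);
  `G(M) := Π^tp_X ⧸ Δ_X` with the quotient topology ("corresponding to `G_k`" via the frame);
* `(l·Δ_Θ)(M)`, `Π_μ(M) = μ_N` and `(l·Δ_Θ)(M) ⊗ ℤ/Nℤ ≅ Π_μ(M)` from part 5a (`intModEquiv`, `muEquivKerProj`),
  `Π_X`-equivariance PROVED (`intModEquiv_conj`, `conjX_inMu`); `Π_μ ≅ ℤ/Nℤ` since `μ_N` is cyclic of order `N`;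
* the outer-action lifting clause via `conjX` (conjugation by `Π^tp_X` on `Π^tp_Y[μ_N]`);
* `def11OutputOfModel`, and — by part 4 (`Def11Output.ofAny`) — `def11OutputOfFrame`: a Def. 1.1 output for
  EVERY mono-theta environment of `S` as soon as ONE of them is identified with the model.

HONEST FRAMING: a construction over a refereed source's typed interface plus three explicit hypotheses; nothing
disputed is asserted; no side is taken on [IUTchIII] Cor. 3.12; typed ≠ discharged. Sources: [IUTchII] §1 Def. 1.1
[claim: Mochizuki2012, status: disputed] (IUTchII §1 Def 1.1, kurims pp.20-21); [cite: MochizukiEtTh2009, Cor 2.18 p.60];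
[cite: MochizukiEtTh2009, Cor 2.19(i) p.64].
-/

noncomputable section

namespace Literature.IUT.HodgeArakelov

universe u

open Literature.AnabelianGeometry.EtaleTheta
open scoped Literature.AnabelianGeometry.EtaleTheta

namespace ModelCyclotomes

variable {N : ℕ+} {l : ℕ} (R : RigidData.{u} N l)

/-! ## Topology of the model: `Π^tp_Y[μ_N] ≃ₜ μ_N × Π^tp_Y`, the projection is a quotient map -/

/-- `Π^tp_Y[μ_N] = μ_N ⋊ Π^tp_Y` is HOMEOMORPHIC to `μ_N × Π^tp_Y` (its topology is the transported product
topology, [EtTh] Def. 2.13 (ii)(a)). [cite: MochizukiEtTh2009, Def 2.13(ii) p.47] -/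
def envHomeoProd : R.env ≃ₜ R.mu × ↥R.PiY where
  toFun x := (x.left, x.right)
  invFun q := ⟨q.1, q.2⟩
  left_inv _ := rfl
  right_inv _ := rfl
  continuous_toFun := continuous_induced_dom
  continuous_invFun := R.continuous_env_mk continuous_fst continuous_snd

/-- The projection `Π^tp_Y[μ_N] ↠ Π^tp_Y` is an open map. [cite: MochizukiEtTh2009, Def 2.13(ii) p.47] -/
theorem isOpenMap_proj : IsOpenMap (CycEnvelope.proj R.augY R.chi) :=
  isOpenMap_snd.comp (envHomeoProd R).isOpenMap

/-- The projection `Π^tp_Y[μ_N] ↠ Π^tp_Y` is a quotient map. [cite: MochizukiEtTh2009, Def 2.13(ii) p.47] -/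
theorem isQuotientMap_proj : Topology.IsQuotientMap (CycEnvelope.proj R.augY R.chi) :=
  (isOpenMap_proj R).isQuotientMap (CycEnvelope.continuous_proj R.augY R.chi)
    SemidirectProduct.rightHom_surjective

/-- If `Π^tp_X` is T₁ then `Ker(Π^tp_Y[μ_N] ↠ Π^tp_Y) = μ_N × {1}` is closed.
[cite: MochizukiEtTh2009, Def 2.13(ii) p.47] -/
theorem isClosed_ker_proj [T1Space R.PiX] :
    IsClosed (((CycEnvelope.proj R.augY R.chi).ker : Subgroup R.env) : Set R.env) :=
  show IsClosed ((fun x : R.env => CycEnvelope.proj R.augY R.chi x) ⁻¹' {1}) from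
    isClosed_singleton.preimage (CycEnvelope.continuous_proj R.augY R.chi)

/-- `proj ∘ conjX x = conj(x) ∘ proj` on underlying elements of `Π^tp_X`.
[cite: MochizukiEtTh2009, Def 2.13(i) p.47] -/
theorem coe_proj_conjX (x : R.PiX) (z : R.env) :
    ((CycEnvelope.proj R.augY R.chi (R.conjX x z) : ↥R.PiY) : R.PiX) =
      x * (CycEnvelope.proj R.augY R.chi z : ↥R.PiY) * x⁻¹ := rfl

/-- … and for the inverse of `conjX x`. [cite: MochizukiEtTh2009, Def 2.13(i) p.47] -/
theorem coe_proj_conjX_symm (x : R.PiX) (z : R.env) :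
    ((CycEnvelope.proj R.augY R.chi ((R.conjX x).symm z) : ↥R.PiY) : R.PiX) =
      x⁻¹ * (CycEnvelope.proj R.augY R.chi z : ↥R.PiY) * x := rfl

/-- `μ_N ≅ ℤ/Nℤ` as abstract groups (`μ_N` is cyclic of order `N`).
[cite: MochizukiEtTh2009, Def 2.13 p.47] -/
def muEquivZMod : R.mu ≃* Multiplicative (ZMod (N : ℕ)) :=
  haveI := R.mu_cyclic
  mulEquivOfCyclicCardEq (by rw [natCard_mu R]; exact (Nat.card_zmod _).symm)

end ModelCyclotomes

/-! ## The frame: how `R : RigidData S.N l` sits in the [IUTchII] §1 setting `S` -/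

/-- HYPOTHESIS STRUCTURE: an [EtTh] rigidity interface `R` FRAMED in the [IUTchII] §1 setting `S` — an
identification `Π^tp_X ≅ S.PiX` carrying `Δ := Ker(aug)` onto `Δ^tp_{X̲̲_k}` (both `rfl` for the setting BUILT from
`R`, bridge B8 part 2 `ThetaSetting.ofThetaEnvData`), together with the three properties of the genuine objects
that the [EtTh] interface does not record: `Π^tp_X` is T₁ (so that the reconstructed kernels are CLOSED, as
Def. 1.1 (i) prints), `Δ_X` is closed, and `l·Δ_Θ ≅ Ẑ(1)` abstractly ([EtTh] §1 p. 12 "`Δ_Θ (≅ Ẑ(1))`").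
[claim: Mochizuki2012, status: disputed] (IUTchII §1 Def 1.1 (i), kurims pp.20-21) -/
structure ModelFrame (S : ThetaSetting.{u}) {l : ℕ} (R : RigidData.{u} S.N l) : Type u where
  /-- `Π^tp_X` of the [EtTh] data identified with `Π^tp_{X̲̲_k}` of the setting -/
  eX : R.PiX ≃ₜ* S.PiX
  /-- … carrying `Δ = Ker(Π^tp_X ↠ G_K)` onto `Δ^tp_{X̲̲_k}` -/
  map_ker : R.aug.ker.map eX.toMulEquiv.toMonoidHom = S.DeltaX
  /-- `Π^tp_X` is a T₁ space -/
  t1Space : T1Space R.PiX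
  /-- `Δ_X = Ker(aug)` is closed in `Π^tp_X` -/
  isClosed_ker_aug : IsClosed ((R.aug.ker : Subgroup R.PiX) : Set R.PiX)
  /-- `(l·Δ_Θ)/Ker((l·Δ_Θ) ↠ its theta-quotient) ≅ Ẑ` as abstract groups -/
  int_iso_ZHat : Nonempty (ModelCyclotomes.lDeltaQuot R ≃* Literature.IUT.HodgeTheaters.ZHat)

variable {S : ThetaSetting.{u}} {l : ℕ} {R : RigidData.{u} S.N l}

namespace ModelFrame

open ModelCyclotomes

variable (F : ModelFrame S R) {M : MonoThetaEnv S} (e : M.Pi ≃ₜ* R.env)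

/-- `Ker(Π_M → Π^tp_Y[μ_N] ↠ Π^tp_Y) = ` the image under `Π^tp_Y[μ_N] ≅ Π_M` of `Ker(proj)`.
[claim: Mochizuki2012, status: disputed] (IUTchII §1 Def 1.1 (i), kurims p.21) -/
theorem ker_proj_comp_eq (e : M.Pi ≃ₜ* R.env) :
    ((CycEnvelope.proj R.augY R.chi).ker).map (e.symm.toMulEquiv : R.env →* M.Pi) =
      ((CycEnvelope.proj R.augY R.chi).comp e.toMulEquiv.toMonoidHom).ker := by
  ext m
  constructor
  · intro hm
    obtain ⟨z, hz, rfl⟩ := Subgroup.mem_map.1 hm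
    show CycEnvelope.proj R.augY R.chi (e (e.symm z)) = 1
    rw [ContinuousMulEquiv.apply_symm_apply]
    exact hz
  · intro hm
    exact Subgroup.mem_map.2 ⟨e m, hm, e.symm_apply_apply m⟩

/-- **The exterior cyclotome of `M` is `μ_N`**: `μ_N ≃* Ker(Π_M ↠ Π_Y(M))`.
[claim: Mochizuki2012, status: disputed] (IUTchII §1 Def 1.1 (i), kurims p.21) -/
def extEquiv (e : M.Pi ≃ₜ* R.env) :
    R.mu ≃* ((CycEnvelope.proj R.augY R.chi).comp e.toMulEquiv.toMonoidHom).ker :=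
  (muEquivKerProj R).trans
    ((e.symm.toMulEquiv.subgroupMap _).trans (MulEquiv.subgroupCongr (ker_proj_comp_eq e)))

/-- `extEquiv` on elements: `a ↦ e⁻¹ (inMu a)`. [claim: Mochizuki2012, status: disputed] (IUTchII §1 Def 1.1 (i), kurims p.21) -/
@[simp] theorem coe_extEquiv (e : M.Pi ≃ₜ* R.env) (a : R.mu) :
    ((extEquiv e a : ((CycEnvelope.proj R.augY R.chi).comp e.toMulEquiv.toMonoidHom).ker) : M.Pi) =
      e.symm (CycEnvelope.inMu R.augY R.chi a) := rfl

/-- **[IUTchII] Def. 1.1 (i) OUTPUT for a mono-theta environment identified with the [EtTh] model.**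
(Reducible, so that its fields compute.) [claim: Mochizuki2012, status: disputed] (IUTchII §1 Def 1.1 (i), kurims pp.20-21) -/
@[reducible] def reconstruction : Reconstruction M where
  PiY := TopGroup.of ↥R.PiY
  projY := (CycEnvelope.proj R.augY R.chi).comp e.toMulEquiv.toMonoidHom
  projY_continuous := (CycEnvelope.continuous_proj R.augY R.chi).comp e.continuous
  projY_surjective := SemidirectProduct.rightHom_surjective.comp e.surjective
  projY_quotientMap := (isQuotientMap_proj R).comp e.toHomeomorph.isQuotientMap
  isClosed_ker_projY := by
    haveI := F.t1Space
    show IsClosed ((fun m : M.Pi => CycEnvelope.proj R.augY R.chi (e m)) ⁻¹' {1})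
    exact isClosed_singleton.preimage ((CycEnvelope.continuous_proj R.augY R.chi).comp e.continuous)
  PiX := TopGroup.of R.PiX
  inclY := R.PiY.subtype
  inclY_isOpenEmbedding := R.PiY_open.isOpenEmbedding_subtypeVal
  inclY_normal := by
    rw [Subgroup.range_subtype]
    exact R.PiY_normal
  G := TopGroup.of (R.PiX ⧸ R.aug.ker)
  projG := QuotientGroup.mk' R.aug.ker
  projG_continuous := QuotientGroup.continuous_mk
  projG_surjective := QuotientGroup.mk'_surjective _
  projG_quotientMap := QuotientGroup.isQuotientMap_mk _
  isClosed_ker_projG := by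
    rw [QuotientGroup.ker_mk']
    exact F.isClosed_ker_aug
  projG_corresponds := ⟨F.eX, by rw [QuotientGroup.ker_mk']; exact F.map_ker⟩
  intCyc := intCyc R
  intAct := intAct R
  int_iso_ZHat := ⟨(intCycEquiv R).trans F.int_iso_ZHat.some⟩
  extAct := (MulAut.congr (extEquiv e)).toMonoidHom.comp (R.chi.comp R.aug)
  ext_iso_ZMod := ⟨(extEquiv e).symm.trans (muEquivZMod R)⟩
  projG_inclY_surjective := by
    intro q
    induction q using QuotientGroup.induction_on with
    | H x =>
      obtain ⟨y, hy⟩ := augY_surjective R (R.aug x)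
      refine ⟨y, ?_⟩
      change (QuotientGroup.mk' R.aug.ker) (y : R.PiX) = QuotientGroup.mk' R.aug.ker x
      rw [QuotientGroup.mk'_eq_mk']
      refine ⟨(y : R.PiX)⁻¹ * x, ?_, by group⟩
      rw [MonoidHom.mem_ker, map_mul, map_inv, ← hy]
      exact inv_mul_cancel _
  outer_action_lifts := by
    intro x
    let ψ : MulAut M.Pi := MulAut.congr e.symm.toMulEquiv (R.conjX x)
    have hψ : ∀ m : M.Pi, ψ m = e.symm (R.conjX x (e m)) := fun m => by
      change e.symm (R.conjX x (e.symm.toMulEquiv.symm m)) = _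
      rfl
    have hψ' : ∀ m : M.Pi, ψ.symm m = e.symm ((R.conjX x).symm (e m)) := fun m => by
      change e.symm ((R.conjX x).symm (e.symm.toMulEquiv.symm m)) = _
      rfl
    have hmem : ∀ m : M.Pi,
        m ∈ ((QuotientGroup.mk' R.aug.ker).comp (R.PiY.subtype.comp
          ((CycEnvelope.proj R.augY R.chi).comp e.toMulEquiv.toMonoidHom))).ker ↔
        R.aug ((CycEnvelope.proj R.augY R.chi (e m) : ↥R.PiY) : R.PiX) = 1 := fun m => by
      rw [MonoidHom.mem_ker, MonoidHom.comp_apply, MonoidHom.comp_apply, QuotientGroup.mk'_apply,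
        QuotientGroup.eq_one_iff, MonoidHom.mem_ker]
      rfl
    have hin : ∀ m : M.Pi, m ∈ ((QuotientGroup.mk' R.aug.ker).comp (R.PiY.subtype.comp
          ((CycEnvelope.proj R.augY R.chi).comp e.toMulEquiv.toMonoidHom))).ker →
        ψ m ∈ ((QuotientGroup.mk' R.aug.ker).comp (R.PiY.subtype.comp
          ((CycEnvelope.proj R.augY R.chi).comp e.toMulEquiv.toMonoidHom))).ker := fun m hm => by
      rw [hmem] at hm ⊢
      rw [hψ, ContinuousMulEquiv.apply_symm_apply, coe_proj_conjX, map_mul, map_mul, hm, mul_one,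
        map_inv, mul_inv_cancel]
    have hin' : ∀ m : M.Pi, m ∈ ((QuotientGroup.mk' R.aug.ker).comp (R.PiY.subtype.comp
          ((CycEnvelope.proj R.augY R.chi).comp e.toMulEquiv.toMonoidHom))).ker →
        ψ.symm m ∈ ((QuotientGroup.mk' R.aug.ker).comp (R.PiY.subtype.comp
          ((CycEnvelope.proj R.augY R.chi).comp e.toMulEquiv.toMonoidHom))).ker := fun m hm => by
      rw [hmem] at hm ⊢
      rw [hψ', ContinuousMulEquiv.apply_symm_apply, coe_proj_conjX_symm, map_mul, map_mul, hm, mul_one,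
        map_inv, inv_mul_cancel]
    refine ⟨{ toFun := fun δ => ⟨ψ δ, hin δ δ.2⟩
              invFun := fun δ => ⟨ψ.symm δ, hin' δ δ.2⟩
              left_inv := fun δ => Subtype.ext (ψ.symm_apply_apply (δ : M.Pi))
              right_inv := fun δ => Subtype.ext (ψ.apply_symm_apply (δ : M.Pi))
              map_mul' := fun δ δ' => Subtype.ext (map_mul ψ (δ : M.Pi) (δ' : M.Pi)) }, fun δ => ?_⟩
    change ((CycEnvelope.proj R.augY R.chi (e (ψ δ)) : ↥R.PiY) : R.PiX) =
      x * (CycEnvelope.proj R.augY R.chi (e δ) : ↥R.PiY) * x⁻¹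
    rw [hψ, ContinuousMulEquiv.apply_symm_apply, coe_proj_conjX]

/-- The interior cyclotome of the output is part 5a's `intCyc R`. [claim: Mochizuki2012, status: disputed] (IUTchII §1 Def 1.1 (i), kurims p.21) -/
@[simp] theorem reconstruction_intCyc : (F.reconstruction e).intCyc = intCyc R := rfl

/-- `Π_X(M) = Π^tp_X`. [claim: Mochizuki2012, status: disputed] (IUTchII §1 Def 1.1 (i), kurims p.21) -/
@[simp] theorem reconstruction_PiX : (F.reconstruction e).PiX = TopGroup.of R.PiX := rfl

/-- The exterior action of the output on `μ_N` is the cyclotomic character `χ ∘ aug`, read through `extEquiv`.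
[claim: Mochizuki2012, status: disputed] (IUTchII §1 Def 1.1 (i), kurims p.21) -/
theorem reconstruction_extAct_apply (x : R.PiX) (y : (F.reconstruction e).extCyc) :
    (F.reconstruction e).extAct x y = extEquiv e (R.chi (R.aug x) ((extEquiv e).symm y)) := rfl

/-- **[IUTchII] Def. 1.1 (ii) OUTPUT for the model**: the cyclotomic rigidity isomorphism
`(l·Δ_Θ)(M) ⊗ ℤ/Nℤ ≅ Π_μ(M)` := (part 5a's `intModEquiv`, induced by L2's `thetaMod`) followed by `μ_N ≅ Π_μ(M)`;
its `Π_X(M)`-equivariance is PROVED (`intModEquiv_conj` + the character action on `μ_N`).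
[claim: Mochizuki2012, status: disputed] (IUTchII §1 Def 1.1 (ii), kurims p.21) -/
def cyclotomicRigidity : CyclotomicRigidity (F.reconstruction e) where
  iso := (intModEquiv R).trans (extEquiv e)
  equivariant x c := by
    show extEquiv e (intModEquiv R ((intAct R x c : (intCyc R).carrier) :
        ModPow (intCyc R).carrier (S.N : ℕ))) =
      extEquiv e (R.chi (R.aug x) ((extEquiv e).symm (extEquiv e
        (intModEquiv R (c : ModPow (intCyc R).carrier (S.N : ℕ))))))
    rw [MulEquiv.symm_apply_apply, intModEquiv_conj]

/-- **The bundled Def. 1.1 output of a mono-theta environment identified with the [EtTh] model.**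
[claim: Mochizuki2012, status: disputed] (IUTchII §1 Def 1.1, kurims pp.20-21) -/
def def11OutputOfModel : Def11Output M where
  recon := F.reconstruction e
  rigidity := F.cyclotomicRigidity e

/-- **Def. 1.1 output for EVERY mono-theta environment of the setting** (part 4's transport along
`MonoThetaEnv.nonempty_iso`), as soon as ONE mono-theta environment `M₀` of `S` is identified with the model.
[claim: Mochizuki2012, status: disputed] (IUTchII §1 Def 1.1, kurims pp.20-21) -/
def def11OutputOfFrame {M₀ : MonoThetaEnv S} (e₀ : M₀.Pi ≃ₜ* R.env) (M : MonoThetaEnv S) : Def11Output M :=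
  (F.def11OutputOfModel e₀).ofAny M

/-- Existence form of the above. [claim: Mochizuki2012, status: disputed] (IUTchII §1 Def 1.1, kurims pp.20-21) -/
theorem nonempty_def11Output (F : ModelFrame S R) {M₀ : MonoThetaEnv S} (e₀ : M₀.Pi ≃ₜ* R.env)
    (M : MonoThetaEnv S) : Nonempty (Def11Output M) :=
  ⟨F.def11OutputOfFrame e₀ M⟩

end ModelFrame

end Literature.IUT.HodgeArakelov
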